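import Summits.QuantumFields.YangMills.Theorems.LuscherReductionOneSiteLevelsPhase
import Summits.QuantumFields.YangMills.Theorems.LuscherReductionOneSiteLevelsLargeField

/-!
# The OUTER seam of crux `OneSiteLevels`: valley bound + large-field suppression + a second IMS cut ⟹ `OneSiteAbsUpperOuter k`
# (support module for the registered stub `stub_absUpperOuter` (skeleton v7 draft) of crux `OneSiteLevels`, route `LuscherReduction`,
# item stmt-QuantumFields-20007; fleet lead prover ym-luscher-20007-p1; line card `Lines/energy-lower-abs.md` (I4))

`OneSiteAbsUpperOuter k` asks for `⟨sin Θ_B ψ, K_B sin Θ_B ψ⟩ ≤ linkCE B·e^{−E_kλ_b + Cλ_b²}‖sin Θ_B ψ‖²` for every physical `ψ`, where the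
`sin Θ_B`-piece lives where some link is farther than `√λ_b` from the centre.  That region is the union of (a) a neighbourhood of the TORON
VALLEY of commuting triples (small magnetic energy `S`) and (b) the LARGE-FIELD region (`S ≥ η`).  A second angular IMS cut `cos Φ_B / sin Φ_B`
along a magnetic phase `Φ_B` (any measurable, gauge/twist-invariant, link-Lipschitz family with `Λ'_B² ≤ A'/λ_b`, whose `sin`-piece lives in
`{S ≥ η_B}` with `e^{−Bη_B}` below the target rate) separates them; (b) is settled by `qform_le_exp_neg_of_action_ge`
(`Theorems/LuscherReductionOneSiteLevelsLargeField.lean`), the cut costs `O(λ_b²)·linkCE` (`qform_le_localized_cos_sin`, `defect_scale`), and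
what remains is the genuinely L-sized VALLEY bound:

  (VALLEY)  `⟨cos Φ_B sin Θ_B ψ, K_B cos Φ_B sin Θ_B ψ⟩ ≤ linkCE B·e^{−E_kλ_b + C₁λ_b²}‖cos Φ_B sin Θ_B ψ‖²`  for every physical `ψ`

— transverse zero-point confinement near the commuting-triple valley at distance `≥ √λ_b` from the torons.  `absUpperOuter_of_valley` proves
OUTER from (PHASE′) + (VALLEY) + the rate condition, with `C = C₁ + e^{|E_k|+|C₁|}·(9/4)·A'·cM2`.

## WHAT THIS IS NOT
Neither the valley bound nor a concrete magnetic phase (e.g. `Φ_B = (π/2)·clamp01(S/η_B − 1)`, whose link-Lipschitz constant is that of the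
Wilson action divided by `η_B`) is constructed here; NOT the crux, NOT THE CLAY GAP.  Sorry-free; no new definition, no named fact.
-/

set_option autoImplicit false

noncomputable section

open MeasureTheory Filter Topology Real
open scoped Matrix ComplexConjugate BigOperators
open Literature.MathematicalPhysics.QuantumFieldTheory
open Literature.MathematicalPhysics.QuantumLattice
open Literature.Analysis.OperatorTheory.YMMatrixModel

namespace Summit.QuantumFields.YangMills.Theorems.FemtoTransferGap

/-- The `sin Θ`-piece of a physical function is physical (for the crux's phase `onePhase ℓ`). [folklore] -/
theorem isPhys_sin_onePhase_mul (ℓ : ℝ) {ψ : Cfg → ℝ} (hψ : IsPhys ψ) :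
    IsPhys (fun U => Real.sin (onePhase ℓ U) * ψ U) :=
  hψ.mul_of_invariant (J := fun U => Real.sin (onePhase ℓ U)) (Real.continuous_sin.measurable.comp (measurable_onePhase ℓ))
    (CJ := 1) (fun U => Real.abs_sin_le_one _) (fun g U => by simp only [onePhase_gaugeTransform])
    (fun k z hz U => by simp only [onePhase_twist ℓ k hz])

/-- **OUTER from VALLEY + large fields.**  Let `Φ_B` be measurable, gauge- and twist-invariant, link-Lipschitz phases with `Λ'_B² ≤ A'/λ_b`
for `B ≥ B₁ ≥ 2`, whose `sin`-piece lives in the large-field region `{S ≥ η_B}` with `e^{−Bη_B} ≤ e^{−E_kλ_b + C₁λ_b²}`; if the VALLEY piece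
`cos Φ_B · sin Θ_B · ψ` of every physical `ψ` obeys the rate `linkCE B·e^{−E_kλ_b + C₁λ_b²}`, then so does the whole `sin Θ_B`-piece, with
`C = C₁ + e^{|E_k|+|C₁|}(9/4)A'·cM2` — i.e. `OneSiteAbsUpperOuter k`. [cite: SimonB1983DiscreteSpectrum, §3] [cite: Luscher1983, §2] -/
theorem absUpperOuter_of_valley (k : ℕ) {A' C₁ B₁ : ℝ} (hB₁ : 2 ≤ B₁) (hA' : 0 ≤ A')
    (Φ : ℝ → Cfg → ℝ) (Λ' η : ℝ → ℝ)
    (hΦm : ∀ B, Measurable (Φ B))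
    (hΦg : ∀ B (g : Site 3 1 → SU2) (U : Cfg), Φ B (gaugeTransform g U) = Φ B U)
    (hΦz : ∀ B (j : Fin 3), ∀ z ∈ Subgroup.center SU2, ∀ U : Cfg, Φ B (twist j z U) = Φ B U)
    (hΛ' : ∀ B, 0 ≤ Λ' B)
    (hLip' : ∀ B (U V : Cfg), |Φ B U - Φ B V|
      ≤ Λ' B * ∑ e, frobNorm ((U e : Matrix (Fin 2) (Fin 2) ℂ) - (V e : Matrix (Fin 2) (Fin 2) ℂ)))
    (hΛ'A : ∀ B, B₁ ≤ B → Λ' B ^ 2 ≤ A' / bareLambda B)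
    (hsupp : ∀ B, B₁ ≤ B → ∀ U : Cfg, Real.sin (Φ B U) ≠ 0 → η B ≤ wilsonAction su2Rep U)
    (hrate : ∀ B, B₁ ≤ B → Real.exp (-(B * η B)) ≤ Real.exp (-(physLevel (k + 1) * bareLambda B) + C₁ * bareLambda B ^ 2))
    (hval : ∀ B, B₁ ≤ B → ∀ ψ : Cfg → ℝ, IsPhys ψ →
      qform su2Rep B (fun U => Real.cos (Φ B U) * (Real.sin (onePhase (onePhaseScale B) U) * ψ U))
          (fun U => Real.cos (Φ B U) * (Real.sin (onePhase (onePhaseScale B) U) * ψ U))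
        ≤ linkCE B * Real.exp (-(physLevel (k + 1) * bareLambda B) + C₁ * bareLambda B ^ 2)
          * l2 (fun U => Real.cos (Φ B U) * (Real.sin (onePhase (onePhaseScale B) U) * ψ U))
               (fun U => Real.cos (Φ B U) * (Real.sin (onePhase (onePhaseScale B) U) * ψ U))) :
    ∃ C₂ B₂ : ℝ, 2 ≤ B₂ ∧ ∀ B, B₂ ≤ B → ∀ ψ : Cfg → ℝ, IsPhys ψ →
      qform su2Rep B (fun U => Real.sin (onePhase (onePhaseScale B) U) * ψ U) (fun U => Real.sin (onePhase (onePhaseScale B) U) * ψ U)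
        ≤ linkCE B * Real.exp (-(physLevel (k + 1) * bareLambda B) + C₂ * bareLambda B ^ 2)
          * l2 (fun U => Real.sin (onePhase (onePhaseScale B) U) * ψ U) (fun U => Real.sin (onePhase (onePhaseScale B) U) * ψ U) := by
  set E := physLevel (k + 1) with hE
  set D : ℝ := 9 / 4 * A' * cM2 with hD
  set M : ℝ := Real.exp (|E| + |C₁|) with hM
  have hD0 : 0 ≤ D := by rw [hD]; have := cM2_pos; positivity
  refine ⟨C₁ + M * D, B₁, hB₁, fun B hB ψ hψ => ?_⟩
  have hBpos : 0 < B := by linarith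
  obtain ⟨hl0, hl1⟩ := bareLambda_pos_le_one (hB₁.trans hB)
  set x := bareLambda B with hx
  set a : ℝ := -(E * x) + C₁ * x ^ 2 with ha
  -- the `sin Θ`-piece as a physical function
  set ψ' : Cfg → ℝ := fun U => Real.sin (onePhase (onePhaseScale B) U) * ψ U with hψ'
  have hψ'P : IsPhys ψ' := isPhys_sin_onePhase_mul _ hψ
  have hCE : linkCE B = linkC B ^ 3 := by rw [linkCE, card_edge_one]
  have hCE0 : 0 ≤ linkCE B := (linkCE_pos hBpos.le).le
  -- IMS along the magnetic phase `Φ_B`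
  have hims := qform_le_localized_cos_sin hBpos (hΦm B) (hΛ' B) (hLip' B) (hΦg B) (hΦz B) hψ'P
  have hscale := defect_scale (Λ := Λ' B) hBpos (hΛ'A B hB)
  -- the valley piece
  have h1 := hval B hB ψ hψ
  -- the large-field piece: `sin Φ · ψ'` lives in `{S ≥ η}`
  have hsinP : IsPhys (fun U => Real.sin (Φ B U) * ψ' U) :=
    hψ'P.mul_of_invariant (J := fun U => Real.sin (Φ B U)) (Real.continuous_sin.measurable.comp (hΦm B))
      (CJ := 1) (fun U => Real.abs_sin_le_one _) (fun g U => by simp only [hΦg B g U]) (fun j z hz U => by simp only [hΦz B j z hz U])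
  have hη : ∀ U, Real.sin (Φ B U) * ψ' U ≠ 0 → η B ≤ wilsonAction su2Rep U :=
    fun U hU => hsupp B hB U (left_ne_zero_of_mul hU)
  have h2 := (qform_le_exp_neg_of_action_ge hBpos.le hsinP hη).trans
    (mul_le_mul_of_nonneg_right (mul_le_mul_of_nonneg_right (hrate B hB) hCE0 |>.trans_eq (mul_comm _ _))
      (by unfold l2; exact integral_nonneg fun U => mul_self_nonneg _))
  -- norms
  have hsum := l2_cos_mul_add_l2_sin_mul (hΦm B) hψ'P
  set nc := l2 (fun U => Real.cos (Φ B U) * ψ' U) (fun U => Real.cos (Φ B U) * ψ' U) with hnc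
  set ns := l2 (fun U => Real.sin (Φ B U) * ψ' U) (fun U => Real.sin (Φ B U) * ψ' U) with hns
  set n := l2 ψ' ψ' with hn
  have hn0 : 0 ≤ n := by rw [hn]; unfold l2; exact integral_nonneg fun U => mul_self_nonneg _
  have herr : (1 / 2) * (9 * Λ' B ^ 2 * (cM2 / B) * linkCE B) * n ≤ linkCE B * (D * x ^ 2) * n := by
    have : (1 / 2) * (9 * Λ' B ^ 2 * (cM2 / B)) ≤ D * x ^ 2 := by rw [hD]; linarith
    calc (1 / 2) * (9 * Λ' B ^ 2 * (cM2 / B) * linkCE B) * n = ((1 / 2) * (9 * Λ' B ^ 2 * (cM2 / B))) * linkCE B * n := by ring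
      _ ≤ (D * x ^ 2) * linkCE B * n := mul_le_mul_of_nonneg_right (mul_le_mul_of_nonneg_right this hCE0) hn0
      _ = linkCE B * (D * x ^ 2) * n := by ring
  have hmain : qform su2Rep B ψ' ψ' ≤ linkCE B * (Real.exp a + D * x ^ 2) * n := by
    have h1' : qform su2Rep B (fun U => Real.cos (Φ B U) * ψ' U) (fun U => Real.cos (Φ B U) * ψ' U)
        ≤ linkCE B * Real.exp a * nc := h1
    have h2' : qform su2Rep B (fun U => Real.sin (Φ B U) * ψ' U) (fun U => Real.sin (Φ B U) * ψ' U)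
        ≤ linkCE B * Real.exp a * ns := h2
    calc qform su2Rep B ψ' ψ' ≤ linkCE B * Real.exp a * nc + linkCE B * Real.exp a * ns
          + (1 / 2) * (9 * Λ' B ^ 2 * (cM2 / B) * linkCE B) * n := by linarith [hims, h1', h2']
      _ = linkCE B * Real.exp a * n + (1 / 2) * (9 * Λ' B ^ 2 * (cM2 / B) * linkCE B) * n := by rw [← hsum]; ring
      _ ≤ linkCE B * Real.exp a * n + linkCE B * (D * x ^ 2) * n := by linarith [herr]
      _ = linkCE B * (Real.exp a + D * x ^ 2) * n := by ring
  -- absorb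
  have hMbd : Real.exp (-a) ≤ M := by
    rw [hM]
    apply Real.exp_le_exp.mpr
    rw [ha]
    have h3 : E * x ≤ |E| := by
      calc E * x ≤ |E| * x := mul_le_mul_of_nonneg_right (le_abs_self E) hl0.le
        _ ≤ |E| * 1 := mul_le_mul_of_nonneg_left hl1 (abs_nonneg E)
        _ = |E| := mul_one _
    have h4 : -(C₁ * x ^ 2) ≤ |C₁| := by
      have hx2 : x ^ 2 ≤ 1 := by nlinarith
      calc -(C₁ * x ^ 2) ≤ |C₁| * x ^ 2 := by nlinarith [neg_abs_le C₁, sq_nonneg x]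
        _ ≤ |C₁| * 1 := mul_le_mul_of_nonneg_left hx2 (abs_nonneg _)
        _ = |C₁| := mul_one _
    linarith
  have habs := exp_add_mul_sq_le (x := x) hD0 hMbd
  have hexp_eq : Real.exp (-(E * x) + (C₁ + M * D) * x ^ 2) = Real.exp (a + M * D * x ^ 2) := by rw [ha]; ring_nf
  rw [hexp_eq]
  calc qform su2Rep B ψ' ψ' ≤ linkCE B * (Real.exp a + D * x ^ 2) * n := hmain
    _ ≤ linkCE B * Real.exp (a + M * D * x ^ 2) * n :=
        mul_le_mul_of_nonneg_right (mul_le_mul_of_nonneg_left habs hCE0) hn0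

end Summit.QuantumFields.YangMills.Theorems.FemtoTransferGap

end
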